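import Mathlib
import Summits.Ventures.HodgeRepro.Tier4.Target
import Summits.Ventures.HodgeRepro.Tier4.Common.TargetBall
import Summits.Ventures.HodgeRepro.Tier4.Common.TargetCalculus
import Summits.Ventures.HodgeRepro.Tier4.Line3.KMDatum
import Summits.Ventures.HodgeRepro.Tier4.Line3.KMDatumS
import Summits.Ventures.HodgeRepro.Tier4.Line3.Defs
import Summits.Ventures.HodgeRepro.Tier4.Line3.HeckeEquivarianceLemmas
import Summits.Ventures.HodgeRepro.Tier4.Line3.CoefInvariance
import Summits.Ventures.HodgeRepro.Tier4.Line3.BallChangeOfVariables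
import Summits.Ventures.HodgeRepro.Tier4.Line3.ScalarAction

/-!
# Tier4/Line3/CentreFibres — the fibres of `Γ′ → ballActions` are the cosets of the scalars (L3.6a, the centre count)

Blind re-derivation cell `pub-hodge-repro`, Tier 4 «PROVE THE STEP» (README §9–§10), LINE L3, seat t4-L3-p1 (prover);
support (R-e of proofs/t4/L3/L36a-support.md) of L3.6a `term_main_unfold` (lead S12253).

CONTENT.  Two elements `γ, γ₀` of `Γ′` give the same map `actM (M(γ)) = actM (M(γ₀))` of `ℂ²` iff `γ₀⁻¹ γ` is a scalar
matrix (`actM_toBallMat_eq_iff`): a scalar acts trivially (`actM_smul_one`), and conversely an element acting trivially on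
the ball is scalar (`eq_smul_one_of_actM_eq`, ScalarAction) — transported from `ℂ` back to `E` through `toBallMat`
(`τ₀` is injective).  Hence the fibre of `γ ↦ actM (M(γ))` over `actM (M(γ₀))` is the coset `γ₀ · Z′` of the scalars
of `Γ′` (`fibreEquivCentre`), and all fibres have `Nat.card = centerCard K` (`natCard_centreFibre`) — the hypothesis of
`FibreCount.tsum_comp_eq_card_smul_tsum` once `Z′` is finite (residual R-c).

Nothing here asserts anything about the truth of (P); HC_CM is NOT proved by anyone in this repository.
-/

set_option autoImplicit false

noncomputable section

namespace Summit.Ventures.HodgeRepro.Tier4.Line3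

open Summit.Ventures.HodgeRepro.Tier4
open Matrix
open HeckeEquivariance

/-- `actM` of a non-zero scalar multiple of `M` is `actM M` (on all of `ℂ²`). -/
theorem actM_smul {c : ℂ} (hc : c ≠ 0) (M : Matrix (Fin 3) (Fin 3) ℂ) (z : Fin 2 → ℂ) :
    actM (c • M) z = actM M z := by
  funext k
  simp only [actM, Matrix.smul_mulVec, Pi.smul_apply, smul_eq_mul]
  rw [mul_div_mul_left _ _ hc]

/-- `toBallMat` of a scalar matrix is the scalar matrix `τ₀ t • 1`. -/
theorem toBallMat_smul_one {E : Type*} [Field E] (τ₀ : E →+* ℂ) {C : Matrix (Fin 3) (Fin 3) ℂ} (hC : IsUnit C)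
    (t : E) : toBallMat τ₀ C (t • (1 : Matrix (Fin 3) (Fin 3) E)) = τ₀ t • (1 : Matrix (Fin 3) (Fin 3) ℂ) := by
  unfold toBallMat
  have h1 : (t • (1 : Matrix (Fin 3) (Fin 3) E)).map τ₀ = τ₀ t • (1 : Matrix (Fin 3) (Fin 3) ℂ) := by
    ext i j
    simp [Matrix.map_apply, Matrix.smul_apply, Matrix.one_apply]
    split_ifs <;> simp
  rw [h1, Matrix.mul_smul, Matrix.mul_one, Matrix.smul_mul, Matrix.nonsing_inv_mul C
    ((Matrix.isUnit_iff_isUnit_det C).mp hC)]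

/-- A matrix over `E` whose image under `τ₀` is a scalar is itself a scalar. -/
theorem eq_smul_one_of_map_eq_smul_one {E : Type*} [Field E] (τ₀ : E →+* ℂ) {g : Matrix (Fin 3) (Fin 3) E}
    {s : ℂ} (h : g.map τ₀ = s • (1 : Matrix (Fin 3) (Fin 3) ℂ)) :
    ∃ t : E, g = t • (1 : Matrix (Fin 3) (Fin 3) E) := by
  refine ⟨g 0 0, ?_⟩
  have hinj : Function.Injective τ₀ := τ₀.injective
  ext i j
  have hij := congrFun (congrFun h i) j
  have h00 := congrFun (congrFun h 0) 0
  simp only [Matrix.map_apply, Matrix.smul_apply, Matrix.one_apply, smul_eq_mul] at hij h00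
  simp only [Matrix.smul_apply, Matrix.one_apply, smul_eq_mul]
  by_cases hij' : i = j
  · subst hij'
    simp only [if_true, mul_one] at hij h00 ⊢
    exact hinj (hij.trans h00.symm)
  · simp only [hij', if_false, mul_zero] at hij ⊢
    exact hinj (by rw [hij, map_zero])

namespace T4Data

variable (X : T4Data)

/-- `toBallMat` of a scalar of `E` is a scalar of `ℂ`, hence acts trivially. -/
theorem actM_toBallMat_smul_one (t : X.E) (ht : t ≠ 0) (z : Fin 2 → ℂ) :
    actM (toBallMat X.τ₀ X.C (t • (1 : Matrix (Fin 3) (Fin 3) X.E))) z = z := by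
  rw [toBallMat_smul_one X.τ₀ X.hC.1 t]
  exact actM_smul_one (by simpa using ht) z

/-- **THE KERNEL OF `Γ′ → ballActions`**: for `γ, γ₀ ∈ Γ′`, `actM (M(γ)) = actM (M(γ₀))` iff `γ₀⁻¹ γ` is a scalar. -/
theorem actM_toBallMat_eq_iff (K : X.Level) {γ γ₀ : Matrix (Fin 3) (Fin 3) X.E} (hγ : γ ∈ K.1) (hγ₀ : γ₀ ∈ K.1) :
    actM (toBallMat X.τ₀ X.C γ) = actM (toBallMat X.τ₀ X.C γ₀) ↔
      ∃ t : X.E, γ = γ₀ * (t • (1 : Matrix (Fin 3) (Fin 3) X.E)) := by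
  obtain ⟨γ₀', hγ₀', hγγ₀', hγ₀'γ⟩ := exists_inv_mem K.2.1 hγ₀
  have hM₀ : (toBallMat X.τ₀ X.C γ₀)ᴴ * J * toBallMat X.τ₀ X.C γ₀ = J :=
    toBallMat_J_of_unitary X (isUnitaryOf_of_mem_level X K hγ₀)
  have hM₀' : (toBallMat X.τ₀ X.C γ₀')ᴴ * J * toBallMat X.τ₀ X.C γ₀' = J :=
    toBallMat_J_of_unitary X (isUnitaryOf_of_mem_level X K hγ₀')
  constructor
  · intro h
    -- `δ := γ₀' γ` acts trivially on the ball
    have hδ : ∀ z ∈ ball, actM (toBallMat X.τ₀ X.C (γ₀' * γ)) z = z := by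
      intro z hz
      have hMγ : (toBallMat X.τ₀ X.C γ)ᴴ * J * toBallMat X.τ₀ X.C γ = J :=
        toBallMat_J_of_unitary X (isUnitaryOf_of_mem_level X K hγ)
      rw [toBallMat_mul X.τ₀ X.hC.1, actM_mul hMγ hz, congrFun h z, ← actM_mul hM₀ hz,
        ← toBallMat_mul X.τ₀ X.hC.1, hγ₀'γ, toBallMat_one X.τ₀ X.hC.1, actM_one']
    have hMδ : (toBallMat X.τ₀ X.C (γ₀' * γ))ᴴ * J * toBallMat X.τ₀ X.C (γ₀' * γ) = J :=
      toBallMat_J_of_unitary X (isUnitaryOf_of_mem_level X K (K.2.1.2.1 γ₀' hγ₀' γ hγ))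
    obtain ⟨s, hs⟩ : ∃ s : ℂ, toBallMat X.τ₀ X.C (γ₀' * γ) = s • (1 : Matrix (Fin 3) (Fin 3) ℂ) :=
      ⟨_, eq_smul_one_of_actM_eq hMδ hδ⟩
    -- transport the scalar back to `E`
    have hmap : (γ₀' * γ).map X.τ₀ = s • (1 : Matrix (Fin 3) (Fin 3) ℂ) := by
      have hCd : IsUnit X.C.det := (Matrix.isUnit_iff_isUnit_det X.C).mp X.hC.1
      have hCC : X.C * X.C⁻¹ = 1 := Matrix.mul_nonsing_inv _ hCd
      have e : toBallMat X.τ₀ X.C (γ₀' * γ) = X.C⁻¹ * (γ₀' * γ).map X.τ₀ * X.C := rfl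
      calc (γ₀' * γ).map X.τ₀ = 1 * (γ₀' * γ).map X.τ₀ * 1 := by rw [Matrix.one_mul, Matrix.mul_one]
        _ = (X.C * X.C⁻¹) * (γ₀' * γ).map X.τ₀ * (X.C * X.C⁻¹) := by rw [hCC]
        _ = X.C * (X.C⁻¹ * (γ₀' * γ).map X.τ₀ * X.C) * X.C⁻¹ := by simp only [Matrix.mul_assoc]
        _ = X.C * (toBallMat X.τ₀ X.C (γ₀' * γ)) * X.C⁻¹ := by rw [← e]
        _ = s • (1 : Matrix (Fin 3) (Fin 3) ℂ) := by
            rw [hs, Matrix.mul_smul, Matrix.mul_one, Matrix.smul_mul, hCC]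
    obtain ⟨t, ht⟩ := eq_smul_one_of_map_eq_smul_one X.τ₀ hmap
    refine ⟨t, ?_⟩
    calc γ = γ₀ * (γ₀' * γ) := by rw [← Matrix.mul_assoc, hγγ₀', Matrix.one_mul]
      _ = γ₀ * (t • (1 : Matrix (Fin 3) (Fin 3) X.E)) := by rw [ht]
  · rintro ⟨t, rfl⟩
    have ht : t ≠ 0 := by
      rintro rfl
      have hd : IsUnit (γ₀ * ((0 : X.E) • (1 : Matrix (Fin 3) (Fin 3) X.E))).det :=
        isUnit_det_of_isUnitaryOf X (isUnitaryOf_of_mem_level X K hγ)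
      rw [zero_smul, Matrix.mul_zero, Matrix.det_zero] at hd
      exact not_isUnit_zero hd
    funext z
    rw [toBallMat_mul X.τ₀ X.hC.1, toBallMat_smul_one X.τ₀ X.hC.1 t, Matrix.mul_smul, Matrix.mul_one,
      actM_smul (by simpa using ht)]

/-- The scalars of `Γ′` (the type whose `Nat.card` is the skeleton's `centerCard K`). -/
abbrev Centre (K : X.Level) : Type :=
  {γ : Matrix (Fin 3) (Fin 3) X.E // γ ∈ K.1 ∧ ∃ t : X.E, γ = t • (1 : Matrix (Fin 3) (Fin 3) X.E)}

/-- The map `Γ′ → ballActions`, `γ ↦ actM (M(γ))`. -/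
def actionMap (K : X.Level) (γ : {γ : Matrix (Fin 3) (Fin 3) X.E // γ ∈ K.1}) : ballActions X.τ₀ X.C K.1 :=
  ⟨actM (toBallMat X.τ₀ X.C γ.1), ⟨γ.1, γ.2, rfl⟩⟩

/-- **THE FIBRE OF `Γ′ → ballActions` over `actM (M(γ₀))` IS THE COSET `γ₀ · Z′`.** -/
def fibreEquivCentre (K : X.Level) (γ₀ : {γ : Matrix (Fin 3) (Fin 3) X.E // γ ∈ K.1}) :
    {γ : {γ : Matrix (Fin 3) (Fin 3) X.E // γ ∈ K.1} // X.actionMap K γ = X.actionMap K γ₀} ≃ X.Centre K where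
  toFun γ := ⟨γ₀.1⁻¹ * γ.1.1, by
    obtain ⟨γ₀', hγ₀', hγγ₀', hγ₀'γ⟩ := exists_inv_mem K.2.1 γ₀.2
    have hd : IsUnit γ₀.1.det := (Matrix.isUnit_iff_isUnit_det _).mp ⟨⟨γ₀.1, γ₀', hγγ₀', hγ₀'γ⟩, rfl⟩
    have hinv : γ₀.1⁻¹ = γ₀' := by
      calc γ₀.1⁻¹ = γ₀.1⁻¹ * (γ₀.1 * γ₀') := by rw [hγγ₀', Matrix.mul_one]
        _ = γ₀' := by rw [← Matrix.mul_assoc, Matrix.nonsing_inv_mul _ hd, Matrix.one_mul]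
    have h := congrArg Subtype.val γ.2
    change actM (toBallMat X.τ₀ X.C γ.1.1) = actM (toBallMat X.τ₀ X.C γ₀.1) at h
    obtain ⟨t, ht⟩ := (X.actM_toBallMat_eq_iff K γ.1.2 γ₀.2).mp h
    refine ⟨by rw [hinv]; exact K.2.1.2.1 γ₀' hγ₀' γ.1.1 γ.1.2, t, ?_⟩
    rw [ht, ← Matrix.mul_assoc, Matrix.nonsing_inv_mul _ hd, Matrix.one_mul]⟩
  invFun δ := ⟨⟨γ₀.1 * δ.1, K.2.1.2.1 γ₀.1 γ₀.2 δ.1 δ.2.1⟩, by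
    apply Subtype.ext
    change actM (toBallMat X.τ₀ X.C (γ₀.1 * δ.1)) = actM (toBallMat X.τ₀ X.C γ₀.1)
    obtain ⟨t, ht⟩ := δ.2.2
    rw [ht]
    exact (X.actM_toBallMat_eq_iff K (K.2.1.2.1 γ₀.1 γ₀.2 δ.1 δ.2.1 |> fun h => by rwa [ht] at h) γ₀.2).mpr
      ⟨t, rfl⟩⟩
  left_inv γ := by
    obtain ⟨γ₀', hγ₀', hγγ₀', hγ₀'γ⟩ := exists_inv_mem K.2.1 γ₀.2
    have hd : IsUnit γ₀.1.det := (Matrix.isUnit_iff_isUnit_det _).mp ⟨⟨γ₀.1, γ₀', hγγ₀', hγ₀'γ⟩, rfl⟩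
    apply Subtype.ext
    apply Subtype.ext
    show γ₀.1 * (γ₀.1⁻¹ * γ.1.1) = γ.1.1
    rw [← Matrix.mul_assoc, Matrix.mul_nonsing_inv _ hd, Matrix.one_mul]
  right_inv δ := by
    obtain ⟨γ₀', hγ₀', hγγ₀', hγ₀'γ⟩ := exists_inv_mem K.2.1 γ₀.2
    have hd : IsUnit γ₀.1.det := (Matrix.isUnit_iff_isUnit_det _).mp ⟨⟨γ₀.1, γ₀', hγγ₀', hγ₀'γ⟩, rfl⟩
    apply Subtype.ext
    show γ₀.1⁻¹ * (γ₀.1 * δ.1) = δ.1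
    rw [← Matrix.mul_assoc, Matrix.nonsing_inv_mul _ hd, Matrix.one_mul]

/-- Every fibre of `Γ′ → ballActions` has `Nat.card = centerCard K`. -/
theorem natCard_centreFibre (K : X.Level) (γ₀ : {γ : Matrix (Fin 3) (Fin 3) X.E // γ ∈ K.1}) :
    Nat.card {γ : {γ : Matrix (Fin 3) (Fin 3) X.E // γ ∈ K.1} // X.actionMap K γ = X.actionMap K γ₀} =
      X.centerCard K :=
  Nat.card_congr (X.fibreEquivCentre K γ₀)

/-- `Γ′ → ballActions` is surjective. -/
theorem actionMap_surjective (K : X.Level) : Function.Surjective (X.actionMap K) := by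
  rintro ⟨φ, γ, hγ, rfl⟩
  exact ⟨⟨γ, hγ⟩, rfl⟩

end T4Data

end Summit.Ventures.HodgeRepro.Tier4.Line3

end
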